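import Summits.QuantumFields.YangMills.Theorems.EquipartitionCriticalityEquipartitionPinsProbeTangentDefs
import Summits.QuantumFields.YangMills.Theorems.EquipartitionCriticalityEquipartitionPinsProbeTangentComb
import Summits.QuantumFields.YangMills.Theorems.EquipartitionCriticalityEquipartitionPinsProbeTangentLieFrame
import Summits.QuantumFields.YangMills.Theorems.EquipartitionCriticalityEquipartitionPinsProbeTangentPlaquetteEnergy
import Summits.QuantumFields.YangMills.Theorems.EquipartitionCriticalityEquipartitionPinsProbeTangentTruncatedFatou
import Summits.QuantumFields.YangMills.Theorems.EquipartitionCriticalityEquipartitionPinsProbeTangentClosedLimit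
import Summits.QuantumFields.YangMills.Theorems.EquipartitionCriticalityEquipartitionPinsProbeTangentCombPoincare
import Summits.QuantumFields.YangMills.Theorems.EquipartitionCriticalityEquipartitionPinsProbeTangentPlaqFieldContinuous
import Summits.QuantumFields.YangMills.Theorems.EquipartitionCriticalityEquipartitionPinsProbeTangentEnergyAlgebra
import HarnessLib

/-!
# Second moments of the tangent laws: uniform bound and the `3D` budget

Crux `stmt-QuantumFields-8760` (`Summit.QuantumFields.YangMills.Theses.EquipartitionCriticality.EquipartitionPinsProbe`),
line `Sketch`, stub `stub_secondMoments` (T2') of the reshaped `stub_tangentCore`.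

Along `β_k → ∞` with torus-limit states `μ_k` under uniform equipartition at the origin, let `τ` be a weak
limit of the laws of the rescaled plaquette field `Y^{β_k} = plaqField r β_k` (an `ℝ^D`-valued `2`-cochain,
`D = lieDim r`). Then (a) `∫ (Y_p^a)² dτ ≤ 3D + 2` for all `p, a` (with integrability), and (b) the budget
`∑_{i<j} ∑_a ∫ (Y_{(0;i,j)}^a)² dτ ≤ 3D`. Proof: compare `Y_p^a = √β (d c)_p`, `c_e = ⟨ρ(Ũ_e) − 1, e_a⟩`
(`Ũ = axialFix U`, the comb gauge) with the holonomy coordinates `Z_p^a = √β ⟨ρ(Ũ_p) − 1, e_a⟩`: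
(E1) `∑_a (Z_p^a)² ≤ β‖ρ(Ũ_p) − 1‖_F² = 2β(N − Re tr ρ(U_p))` (Bessel `stub_lieFrame`,
`TangentCombPoincare.norm_sub_one_sq`, gauge invariance), whose expectation is `≤ 3D + 2` eventually
(`stub_plaquetteEnergy`) and, summed over the six planes at the origin, `≤ 3D + 2ε'` eventually (equipartition);
(E2) `|Y_p^a − Z_p^a| ≤ √β K ∑_i (N − Re tr ρ(Ũ_{∂ᵢp}))` (`stub_energyAlgebra`) and the comb Poincaré
inequality (`stub_combPoincare`) give `E|Y_p^a − Z_p^a| ≤ const/√β_k`, so `Y − Z → 0` in probability (Markov);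
then `stub_truncatedFatou`, the weak convergence tested on `min((Y_p^a)², M)`, `η → 0` and monotone
convergence in `M` (`lintegral_iSup`) give the claims.

Reference: S. Chatterjee, arXiv:1602.01222, §§9–11. Mathlib and the line's landed files only.
-/

noncomputable section

open MeasureTheory Filter Topology
open scoped Matrix ENNReal
open Literature.Probability.LatticeModels Literature.MathematicalPhysics.QuantumLattice
open Literature.MathematicalPhysics.QuantumFieldTheory

namespace Summit.QuantumFields.YangMills.Theorems.EquipartitionPinsProbe

namespace TangentSecondMoments

/-! ### Energy algebra and continuity -/

section Gauge

variable {G : Type} [Group G]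

/-- Gauge invariance: the plaquette observables of the comb-gauge-fixed configuration `axialFix U`
are those of `U` (`axialFix U` is a gauge transform of `U`). -/
theorem plaquetteObs_axialFix {N : ℕ} (ρ : G →* Matrix (Fin N) (Fin N) ℂ) (U : LGConfig 4 G)
    (x : Site 4) (i j : Fin 4) : plaquetteObs ρ x i j (axialFix U) = plaquetteObs ρ x i j U :=
  isZdGaugeInvariant_plaquetteObs ρ x i j (combTransport U) U

end Gauge

section Energy

variable {G : Type} [Group G] [TopologicalSpace G] (r : LatticeRep G)

/-- (E1) Bessel's inequality for the orthonormal frame `e_a` and `‖V − 1‖_F² = 2 (N − Re tr V)`: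
`∑_a ⟨ρ(g) − 1, e_a⟩² ≤ ‖ρ(g) − 1‖_F² = 2 (N − Re tr ρ(g))`. -/
theorem sum_lieCoord_sq_le [CompactSpace G] (g : G) :
    ∑ a, (lieCoord r (r.ρ g - 1) a) ^ 2 ≤ 2 * ((r.N : ℝ) - (r.ρ g).trace.re) := by
  rw [← TangentCombPoincare.norm_sub_one_sq (r.mem_unitary g), ← TangentLieFrame.trace_mul_conjTranspose_re]
  exact (stub_lieFrame G r).2.2.2.2 _

/-- `Y_p^a = √β · (curl of the link coordinates)`: the factor `√β` pulls out of `plaquetteCurl`. -/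
theorem plaqField_eq_sqrt_mul (β : ℝ) (U : LGConfig 4 G) (p : ZdPlaquette 4) (a : Fin (lieDim r)) :
    plaqField r β U p a = Real.sqrt β * plaquetteCurl (fun e => lieCoord r (r.ρ (axialFix U e) - 1) a) p := by
  simp only [plaqField, linkField, plaquetteCurl, Finset.mul_sum]
  exact Finset.sum_congr rfl fun i _ => by ring

/-- The holonomy coordinate `U ↦ ⟨ρ(Ũ_p) − 1, e_a⟩` of the gauge-fixed configuration is continuous. -/
theorem continuous_holCoord [IsTopologicalGroup G] (p : ZdPlaquette 4) (a : Fin (lieDim r)) :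
    Continuous fun U : LGConfig 4 G => lieCoord r (r.ρ (plaquetteHolonomyZd (axialFix U) p.1 p.2.1.1 p.2.1.2) - 1) a := by
  refine (TangentPlaqFieldContinuous.continuous_lieCoord r a).comp ((r.continuous.comp ?_).sub continuous_const)
  simp only [plaquetteHolonomyZd]
  exact (((TangentPlaqFieldContinuous.continuous_axialFix _).mul (TangentPlaqFieldContinuous.continuous_axialFix _)).mul
    (TangentPlaqFieldContinuous.continuous_axialFix _).inv).mul (TangentPlaqFieldContinuous.continuous_axialFix _).inv

end Energy

/-! ### Measure-theoretic lemmas -/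

section Measure

variable {Ω : Type*} [MeasurableSpace Ω]

/-- Markov: if `|f| ≤ c W` pointwise with `W` integrable, then `μ {δ < |f|} ≤ c (∫ W dμ) / δ`. -/
theorem measureReal_lt_abs_le {μ : Measure Ω} [IsFiniteMeasure μ] {f W : Ω → ℝ} {c : ℝ}
    (h : ∀ ω, |f ω| ≤ c * W ω) (hW : Integrable W μ) {δ : ℝ} (hδ : 0 < δ) :
    μ.real {ω | δ < |f ω|} ≤ c * (∫ ω, W ω ∂μ) / δ := by
  have hsub : {ω | δ < |f ω|} ⊆ {ω | δ ≤ c * W ω} := fun ω (hω : δ < |f ω|) => hω.le.trans (h ω)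
  have hmk := mul_meas_ge_le_integral_of_nonneg (ae_of_all μ fun ω => (abs_nonneg _).trans (h ω)) (hW.const_mul c) δ
  rw [integral_const_mul] at hmk
  rw [le_div_iff₀ hδ, mul_comm]
  exact (mul_le_mul_of_nonneg_left (measureReal_mono hsub) hδ.le).trans hmk

/-- **Integrability from truncated bounds** (monotone convergence): if `g ≥ 0` is measurable and
`∫ min(g, M) dτ ≤ B` for every `M > 0` (finite `τ`), then `g` is integrable and `∫ g dτ ≤ B`. -/
theorem integrable_of_integral_min_le {τ : Measure Ω} [IsFiniteMeasure τ] {g : Ω → ℝ} (hg : Measurable g)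
    (hg0 : ∀ x, 0 ≤ g x) {B : ℝ} (h : ∀ M : ℝ, 0 < M → ∫ x, min (g x) M ∂τ ≤ B) :
    Integrable g τ ∧ ∫ x, g x ∂τ ≤ B := by
  have hB : 0 ≤ B := (integral_nonneg fun x => le_min (hg0 x) zero_le_one).trans (h 1 one_pos)
  have hint : ∀ n : ℕ, Integrable (fun x => min (g x) ((n : ℝ) + 1)) τ := fun n =>
    Integrable.of_bound (hg.min measurable_const).aestronglyMeasurable ((n : ℝ) + 1) (ae_of_all _ fun x => by
      rw [Real.norm_eq_abs, abs_of_nonneg (le_min (hg0 x) (by positivity))]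
      exact min_le_right _ _)
  have key : ∫⁻ x, ENNReal.ofReal (g x) ∂τ ≤ ENNReal.ofReal B := by
    have hsup : ∀ x, ENNReal.ofReal (g x) = ⨆ n : ℕ, ENNReal.ofReal (min (g x) ((n : ℝ) + 1)) := fun x => by
      refine le_antisymm ?_ (iSup_le fun n => ENNReal.ofReal_le_ofReal (min_le_left _ _))
      obtain ⟨n, hn⟩ := exists_nat_ge (g x)
      exact le_iSup_of_le n (by rw [min_eq_left (hn.trans (le_add_of_nonneg_right zero_le_one))])
    calc ∫⁻ x, ENNReal.ofReal (g x) ∂τ = ∫⁻ x, ⨆ n : ℕ, ENNReal.ofReal (min (g x) ((n : ℝ) + 1)) ∂τ :=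
          lintegral_congr hsup
      _ = ⨆ n : ℕ, ∫⁻ x, ENNReal.ofReal (min (g x) ((n : ℝ) + 1)) ∂τ :=
          lintegral_iSup (fun n => (hg.min measurable_const).ennreal_ofReal) (fun n m hnm x =>
            ENNReal.ofReal_le_ofReal (min_le_min_left _ (by exact_mod_cast Nat.succ_le_succ hnm)))
      _ ≤ ENNReal.ofReal B := iSup_le fun n => by
          rw [← ofReal_integral_eq_lintegral_ofReal (hint n) (ae_of_all _ fun x => le_min (hg0 x) (by positivity))]
          exact ENNReal.ofReal_le_ofReal (h _ (by positivity))
  have hgi : Integrable g τ :=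
    ⟨hg.aestronglyMeasurable, (hasFiniteIntegral_iff_ofReal (ae_of_all _ hg0)).2 (key.trans_lt ENNReal.ofReal_lt_top)⟩
  refine ⟨hgi, ?_⟩
  rw [integral_eq_lintegral_of_nonneg_ae (ae_of_all _ hg0) hgi.aestronglyMeasurable]
  exact ENNReal.toReal_le_of_le_ofReal hB key

/-- Monotone convergence of the truncations: `∫ min(g, n + 1) dτ → ∫ g dτ` for integrable `g ≥ 0`. -/
theorem tendsto_integral_min {τ : Measure Ω} {g : Ω → ℝ} (hg : Integrable g τ) (hg0 : ∀ x, 0 ≤ g x) :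
    Tendsto (fun n : ℕ => ∫ x, min (g x) ((n : ℝ) + 1) ∂τ) atTop (𝓝 (∫ x, g x ∂τ)) := by
  refine integral_tendsto_of_tendsto_of_monotone (fun n => ?_) hg (ae_of_all _ fun x n m hnm => ?_)
    (ae_of_all _ fun x => ?_)
  · exact hg.mono' (hg.aestronglyMeasurable.aemeasurable.min aemeasurable_const).aestronglyMeasurable
      (ae_of_all _ fun x => by
        rw [Real.norm_eq_abs, abs_of_nonneg (le_min (hg0 x) (by positivity))]
        exact min_le_left _ _)
  · exact min_le_min_left _ (by exact_mod_cast Nat.succ_le_succ hnm)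
  · exact tendsto_atTop_of_eventually_const (i₀ := ⌈g x⌉₊) fun n hn => min_eq_left
      ((Nat.le_ceil (g x)).trans ((Nat.cast_le.2 hn).trans (le_add_of_nonneg_right zero_le_one)))

/-- Linearity of the integral for a doubly weighted finite sum of integrable functions. -/
theorem integral_const_mul_sum_mul_sum {ι κ : Type*} (μ : Measure Ω) (s : Finset ι) (c : ℝ) (C : ι → ℝ)
    (S : ι → Finset κ) (E : κ → Ω → ℝ) (hE : ∀ q, Integrable (E q) μ) :
    ∫ ω, c * ∑ i ∈ s, C i * ∑ q ∈ S i, E q ω ∂μ = c * ∑ i ∈ s, C i * ∑ q ∈ S i, ∫ ω, E q ω ∂μ := by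
  rw [integral_const_mul, integral_finsetSum s fun i _ => (integrable_finsetSum (S i) fun q _ => hE q).const_mul (C i)]
  refine congrArg _ (Finset.sum_congr rfl fun i _ => ?_)
  rw [integral_const_mul, integral_finsetSum (S i) fun q _ => hE q]

end Measure

/-! ### Elementary real-variable lemmas -/

/-- `I ≤ (1 + η) B + η` for all `η > 0` (with `B ≥ 0`) forces `I ≤ B`. -/
theorem le_of_forall_le_one_add_mul {I B : ℝ} (hB : 0 ≤ B) (h : ∀ η : ℝ, 0 < η → I ≤ (1 + η) * B + η) :
    I ≤ B :=
  le_of_forall_pos_le_add fun ε hε =>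
    calc I ≤ (1 + ε / (B + 1)) * B + ε / (B + 1) := h (ε / (B + 1)) (by positivity)
      _ = B + ε := by field_simp; ring

/-- Re-indexing the six coordinate planes: a sum over `{q : Fin 4 × Fin 4 // q.1 < q.2}` is the
`if i < j`-guarded double sum. -/
theorem sum_subtype_lt (g : Fin 4 × Fin 4 → ℝ) :
    ∑ q : {q : Fin 4 × Fin 4 // q.1 < q.2}, g q.1 = ∑ i : Fin 4, ∑ j : Fin 4, if i < j then g (i, j) else 0 := by
  rw [← Finset.sum_subtype (Finset.univ.filter fun q : Fin 4 × Fin 4 => q.1 < q.2) (fun q => by simp) g,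
    Finset.sum_filter, Fintype.sum_prod_type]

/-- Re-indexing the six coordinate planes, dependent version (`if h : i < j`-guarded double sum). -/
theorem sum_subtype_lt_dite (F : {q : Fin 4 × Fin 4 // q.1 < q.2} → ℝ) :
    ∑ q, F q = ∑ i : Fin 4, ∑ j : Fin 4, if h : i < j then F ⟨(i, j), h⟩ else 0 := by
  rw [show ∑ q, F q = ∑ q : {q : Fin 4 × Fin 4 // q.1 < q.2}, (if h : q.1.1 < q.1.2 then F ⟨q.1, h⟩ else 0) from
      Finset.sum_congr rfl fun q _ => by simp only [dif_pos q.2, Subtype.coe_eta],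
    sum_subtype_lt fun q => if h : q.1 < q.2 then F ⟨q, h⟩ else 0]
  exact Finset.sum_congr rfl fun i _ => Finset.sum_congr rfl fun j _ => by by_cases hij : i < j <;> simp [hij]

end TangentSecondMoments

/-- STUB `stub_secondMoments` (T2') of line `Sketch` (crux `stmt-QuantumFields-8760`) — **second moments
of the tangent laws**: along `β_k → ∞` with torus-limit states `μ_k` under uniform equipartition, every
weak limit `τ` of the laws of the rescaled plaquette field `Y^{β_k}` has uniformly bounded second moments
`∫ (Y_p^a)² dτ ≤ 3D + 2` (all `p`, `a`) and satisfies the budget `∑_{i<j} ∑_a ∫ (Y_{(0;i,j)}^a)² dτ ≤ 3D`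
(comparison with the holonomy coordinates `√β ⟨ρ(Ũ_p) − 1, e_a⟩` in probability, Bessel, the uniform
plaquette energy bound, truncated Fatou, weak convergence and monotone convergence). -/
theorem stub_secondMoments :
    ∀ (G : Type) [Group G] [TopologicalSpace G] [IsTopologicalGroup G] [CompactSpace G],
      Literature.MathematicalPhysics.QuantumFieldTheory.IsCompactSimpleLieGroup G →
      letI : MeasurableSpace G := borel G
      haveI : BorelSpace G := ⟨rfl⟩
      ∀ r : Literature.MathematicalPhysics.QuantumFieldTheory.LatticeRep G,
        (∀ ε : ℝ, 0 < ε → ∀ᶠ β : ℝ in Filter.atTop,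
          ∀ μ ∈ Literature.MathematicalPhysics.QuantumLattice.infiniteVolumeLimitPoints (d := 4) r.ρ β,
            |β * (∫ U, (∑ i : Fin 4, ∑ j : Fin 4,
                if i < j then ((r.N : ℝ) - Literature.MathematicalPhysics.QuantumLattice.plaquetteObs r.ρ 0 i j U) else 0) ∂μ) -
              3 * (Summit.QuantumFields.YangMills.Theorems.EquipartitionPinsProbe.lieDim r : ℝ) / 2| < ε) →
        ∀ (β : ℕ → ℝ) (μ : ℕ → MeasureTheory.Measure (Literature.MathematicalPhysics.QuantumLattice.LGConfig 4 G)),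
          Filter.Tendsto β Filter.atTop Filter.atTop →
          (∀ k, μ k ∈ Literature.MathematicalPhysics.QuantumLattice.infiniteVolumeLimitPoints (d := 4) r.ρ (β k)) →
          ∀ τ : MeasureTheory.Measure (Literature.MathematicalPhysics.QuantumLattice.ZdPlaquette 4 → Fin (Summit.QuantumFields.YangMills.Theorems.EquipartitionPinsProbe.lieDim r) → ℝ),
            MeasureTheory.IsProbabilityMeasure τ →
            (∀ f : (Literature.MathematicalPhysics.QuantumLattice.ZdPlaquette 4 → Fin (Summit.QuantumFields.YangMills.Theorems.EquipartitionPinsProbe.lieDim r) → ℝ) → ℝ, Continuous f →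
                (∃ C : ℝ, ∀ Y, |f Y| ≤ C) →
              Filter.Tendsto (fun k : ℕ => ∫ U, f (Summit.QuantumFields.YangMills.Theorems.EquipartitionPinsProbe.plaqField r (β k) U) ∂(μ k)) Filter.atTop
                (nhds (∫ Y, f Y ∂τ))) →
            (∃ B : ℝ, ∀ (p : Literature.MathematicalPhysics.QuantumLattice.ZdPlaquette 4) (a : Fin (Summit.QuantumFields.YangMills.Theorems.EquipartitionPinsProbe.lieDim r)),
                MeasureTheory.Integrable (fun Y => (Y p a) ^ 2) τ ∧ ∫ Y, (Y p a) ^ 2 ∂τ ≤ B) ∧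
            (∑ i : Fin 4, ∑ j : Fin 4, ∑ a : Fin (Summit.QuantumFields.YangMills.Theorems.EquipartitionPinsProbe.lieDim r),
                if hij : i < j then ∫ Y, (Y ((0 : Literature.Probability.LatticeModels.Site 4), ⟨(i, j), hij⟩) a) ^ 2 ∂τ else 0) ≤
              3 * (Summit.QuantumFields.YangMills.Theorems.EquipartitionPinsProbe.lieDim r : ℝ) := by
  intro G _ _ _ _ hG r hequi β μ hβ hμ τ hτ hweak
  letI : MeasurableSpace G := borel G
  haveI : BorelSpace G := ⟨rfl⟩
  haveI : SecondCountableTopology G := (r.continuous.isClosedEmbedding r.injective).isEmbedding.secondCountableTopology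
  haveI : IsProbabilityMeasure τ := hτ
  have hprob : ∀ k, IsProbabilityMeasure (μ k) := fun k => by obtain ⟨L, -, hp, -⟩ := hμ k; exact hp
  -- constants: energy algebra (TA), comb Poincaré (TC2), uniform plaquette energy (TE)
  obtain ⟨K, hK⟩ := stub_energyAlgebra G r
  choose S C hC0 hC using stub_combPoincare G r.ρ r.mem_unitary
  set A : ℝ := 3 * (lieDim r : ℝ) / 2 + 1
  have hPE : ∀ᶠ k : ℕ in atTop, ∀ μ' ∈ infiniteVolumeLimitPoints (d := 4) r.ρ (β k), ∀ q : ZdPlaquette 4,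
      Integrable (fun U => (r.N : ℝ) - plaquetteObs r.ρ q.1 q.2.1.1 q.2.1.2 U) μ' ∧
        β k * ∫ U, ((r.N : ℝ) - plaquetteObs r.ρ q.1 q.2.1.1 q.2.1.2 U) ∂μ' ≤ A :=
    hβ.eventually (stub_plaquetteEnergy G hG r hequi)
  have hβ0 : ∀ᶠ k : ℕ in atTop, 0 ≤ β k := hβ.eventually (eventually_ge_atTop 0)
  -- the objects: plaquette energies `E`, holonomy coordinates `ζ` (`Z = √β ζ`), comparison weight `W`
  set E : ZdPlaquette 4 → LGConfig 4 G → ℝ := fun q U => (r.N : ℝ) - plaquetteObs r.ρ q.1 q.2.1.1 q.2.1.2 U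
  set ζ : LGConfig 4 G → ZdPlaquette 4 → Fin (lieDim r) → ℝ := fun U p a =>
    lieCoord r (r.ρ (plaquetteHolonomyZd (axialFix U) p.1 p.2.1.1 p.2.1.2) - 1) a
  set W : ZdPlaquette 4 → LGConfig 4 G → ℝ := fun p U =>
    max K 0 * ∑ i : Fin 4, C (plaquetteBoundary p i) * ∑ q ∈ S (plaquetteBoundary p i), E q U
  set L : ZdPlaquette 4 → ℝ := fun p =>
    max K 0 * ∑ i : Fin 4, C (plaquetteBoundary p i) * ∑ _q ∈ S (plaquetteBoundary p i), A
  -- pointwise facts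
  have hEi : ∀ (k : ℕ) (q : ZdPlaquette 4), Integrable (E q) (μ k) := fun k q => by
    haveI := hprob k
    exact TangentPlaquetteEnergy.integrable_sub_plaquetteObs r.ρ r.continuous r.mem_unitary (μ k) _ _ _
  have hYZ : ∀ (b : ℝ) (U : LGConfig 4 G) (p : ZdPlaquette 4) (a : Fin (lieDim r)),
      |plaqField r b U p a - Real.sqrt b * ζ U p a| ≤ Real.sqrt b * W p U := by
    intro b U p a
    rw [TangentSecondMoments.plaqField_eq_sqrt_mul, ← mul_sub, abs_mul, abs_of_nonneg (Real.sqrt_nonneg b)]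
    refine mul_le_mul_of_nonneg_left ((hK U p a).trans ?_) (Real.sqrt_nonneg b)
    calc K * ∑ i : Fin 4, ((r.N : ℝ) - (r.ρ (axialFix U (plaquetteBoundary p i))).trace.re)
        ≤ max K 0 * ∑ i : Fin 4, ((r.N : ℝ) - (r.ρ (axialFix U (plaquetteBoundary p i))).trace.re) :=
          mul_le_mul_of_nonneg_right (le_max_left K 0) (Finset.sum_nonneg fun i _ =>
            sub_nonneg.2 (TangentCombPoincare.re_trace_le r.ρ r.mem_unitary _))
      _ ≤ W p U := mul_le_mul_of_nonneg_left (Finset.sum_le_sum fun i _ => hC _ U) (le_max_right K 0)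
  have hζsq : ∀ (U : LGConfig 4 G) (p : ZdPlaquette 4), ∑ a, (ζ U p a) ^ 2 ≤ 2 * E p U := by
    intro U p
    have h := TangentSecondMoments.sum_lieCoord_sq_le r (plaquetteHolonomyZd (axialFix U) p.1 p.2.1.1 p.2.1.2)
    rwa [show (r.ρ (plaquetteHolonomyZd (axialFix U) p.1 p.2.1.1 p.2.1.2)).trace.re = plaquetteObs r.ρ p.1 p.2.1.1 p.2.1.2 U
      from TangentSecondMoments.plaquetteObs_axialFix r.ρ U p.1 _ _] at h
  have hζm : ∀ (p : ZdPlaquette 4) (a : Fin (lieDim r)), Measurable fun U : LGConfig 4 G => ζ U p a := fun p a =>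
    (TangentSecondMoments.continuous_holCoord r p a).measurable
  have hWi : ∀ (k : ℕ) (p : ZdPlaquette 4), Integrable (W p) (μ k) := fun k p =>
    (integrable_finsetSum _ fun i _ => (integrable_finsetSum _ fun q _ => hEi k q).const_mul _).const_mul _
  have hζi : ∀ (k : ℕ) (p : ZdPlaquette 4) (a : Fin (lieDim r)),
      Integrable (fun U => (Real.sqrt (β k) * ζ U p a) ^ 2) (μ k) := by
    intro k p a
    refine ((hEi k p).const_mul (2 * Real.sqrt (β k) ^ 2)).mono'
      (((hζm p a).const_mul _).pow_const 2).aestronglyMeasurable (ae_of_all _ fun U => ?_)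
    rw [Real.norm_eq_abs, abs_of_nonneg (sq_nonneg _), mul_pow]
    have h1 : (ζ U p a) ^ 2 ≤ 2 * E p U :=
      (Finset.single_le_sum (fun a' _ => sq_nonneg (ζ U p a')) (Finset.mem_univ a)).trans (hζsq U p)
    calc Real.sqrt (β k) ^ 2 * (ζ U p a) ^ 2 ≤ Real.sqrt (β k) ^ 2 * (2 * E p U) := mul_le_mul_of_nonneg_left h1 (sq_nonneg _)
      _ = 2 * Real.sqrt (β k) ^ 2 * E p U := by ring
  -- (E1) integrated: `∑_a ∫ (Z_p^a)² dμ_k ≤ 2 β_k ∫ E_p dμ_k`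
  have hζsum : ∀ (k : ℕ) (p : ZdPlaquette 4), 0 ≤ β k →
      ∑ a, ∫ U, (Real.sqrt (β k) * ζ U p a) ^ 2 ∂μ k ≤ 2 * (β k * ∫ U, E p U ∂μ k) := by
    intro k p hb
    rw [← integral_finsetSum _ fun a _ => hζi k p a, ← integral_const_mul, ← integral_const_mul]
    refine integral_mono (integrable_finsetSum _ fun a _ => hζi k p a) (((hEi k p).const_mul _).const_mul _) fun U => ?_
    dsimp only
    simp only [mul_pow, Real.sq_sqrt hb, ← Finset.mul_sum]
    calc β k * ∑ a, (ζ U p a) ^ 2 ≤ β k * (2 * E p U) := mul_le_mul_of_nonneg_left (hζsq U p) hb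
      _ = 2 * (β k * E p U) := by ring
  have hWint : ∀ (k : ℕ) (p : ZdPlaquette 4), β k * ∫ U, W p U ∂μ k = max K 0 * ∑ i : Fin 4,
      C (plaquetteBoundary p i) * ∑ q ∈ S (plaquetteBoundary p i), β k * ∫ U, E q U ∂μ k := by
    intro k p
    rw [TangentSecondMoments.integral_const_mul_sum_mul_sum (μ k) _ _ _ _ E (hEi k), mul_left_comm, Finset.mul_sum]
    refine congrArg _ (Finset.sum_congr rfl fun i _ => ?_)
    rw [mul_left_comm, Finset.mul_sum]
  -- (E2) convergence in probability of `Y − Z` (Markov, uniform plaquette energy bound, `β_k → ∞`)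
  have hconv : ∀ (p : ZdPlaquette 4) (a : Fin (lieDim r)) (δ : ℝ), 0 < δ → Tendsto (fun k : ℕ =>
      (μ k).real {U | δ < |plaqField r (β k) U p a - Real.sqrt (β k) * ζ U p a|}) atTop (𝓝 0) := by
    intro p a δ hδ
    have hup : ∀ᶠ k : ℕ in atTop, (μ k).real {U | δ < |plaqField r (β k) U p a - Real.sqrt (β k) * ζ U p a|} ≤
        L p / (δ * Real.sqrt (β k)) := by
      filter_upwards [hPE, hβ.eventually (eventually_gt_atTop 0)] with k hk hk0
      haveI := hprob k
      have h2 : β k * ∫ U, W p U ∂μ k ≤ L p := by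
        rw [hWint k p]
        exact mul_le_mul_of_nonneg_left (Finset.sum_le_sum fun i _ => mul_le_mul_of_nonneg_left
          (Finset.sum_le_sum fun q _ => (hk (μ k) (hμ k) q).2) (hC0 _)) (le_max_right K 0)
      refine (TangentSecondMoments.measureReal_lt_abs_le (fun U => hYZ (β k) U p a) (hWi k p) hδ).trans ?_
      rw [div_le_div_iff₀ hδ (mul_pos hδ (Real.sqrt_pos.2 hk0))]
      have hbb : Real.sqrt (β k) * Real.sqrt (β k) = β k := Real.mul_self_sqrt hk0.le
      calc Real.sqrt (β k) * (∫ U, W p U ∂μ k) * (δ * Real.sqrt (β k)) = δ * (β k * ∫ U, W p U ∂μ k) := by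
            linear_combination (δ * ∫ U, W p U ∂μ k) * hbb
        _ ≤ δ * L p := mul_le_mul_of_nonneg_left h2 hδ.le
        _ = L p * δ := mul_comm _ _
    exact tendsto_of_tendsto_of_tendsto_of_le_of_le' tendsto_const_nhds
      (tendsto_const_nhds.div_atTop ((Real.tendsto_sqrt_atTop.comp hβ).const_mul_atTop hδ))
      (Eventually.of_forall fun k => measureReal_nonneg) hup
  -- the core: truncated Fatou along `μ_k`, then the weak limit, for a finite family of coordinates
  have core : ∀ (T : Type) [Fintype T] (pt : T → ZdPlaquette 4) (ct : T → Fin (lieDim r)) (B : ℝ),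
      (∀ᶠ k : ℕ in atTop, ∑ t, ∫ U, (Real.sqrt (β k) * ζ U (pt t) (ct t)) ^ 2 ∂μ k ≤ B) →
      ∀ M : ℝ, 0 < M → ∑ t, ∫ Y, min ((Y (pt t) (ct t)) ^ 2) M ∂τ ≤ B := by
    intro T _ pt ct B hB M hM
    have hB0 : 0 ≤ B := by
      obtain ⟨k, hk⟩ := hB.exists
      exact (Finset.sum_nonneg fun t _ => integral_nonneg fun U => sq_nonneg _).trans hk
    have hTF := stub_truncatedFatou (LGConfig 4 G) T μ hprob (fun t k U => plaqField r (β k) U (pt t) (ct t))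
      (fun t k U => Real.sqrt (β k) * ζ U (pt t) (ct t))
      (fun t k => (TangentPlaqFieldContinuous.continuous_plaqField_apply r _ _ _).measurable)
      (fun t k => (hζm _ _).const_mul _) (fun t δ hδ => hconv (pt t) (ct t) δ hδ) B
      (hB.mono fun k hk => ⟨fun t => hζi k _ _, hk⟩) M
    refine TangentSecondMoments.le_of_forall_le_one_add_mul hB0 fun η hη => ?_
    have hlim : Tendsto (fun k : ℕ => ∑ t, ∫ U, min ((plaqField r (β k) U (pt t) (ct t)) ^ 2) M ∂μ k) atTop
        (𝓝 (∑ t, ∫ Y, min ((Y (pt t) (ct t)) ^ 2) M ∂τ)) :=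
      tendsto_finsetSum _ fun t _ => hweak (fun Y => min ((Y (pt t) (ct t)) ^ 2) M)
        (((TangentClosedLimit.continuous_eval₂ _ _).pow 2).min continuous_const)
        ⟨M, fun Y => by rw [abs_of_nonneg (le_min (sq_nonneg _) hM.le)]; exact min_le_right _ _⟩
    exact le_of_tendsto hlim (hTF η hM hη)
  -- (a) uniform second moments
  have partA : ∀ (p : ZdPlaquette 4) (a : Fin (lieDim r)),
      Integrable (fun Y => (Y p a) ^ 2) τ ∧ ∫ Y, (Y p a) ^ 2 ∂τ ≤ 2 * A := by
    intro p a
    have hBd : ∀ᶠ k : ℕ in atTop, ∑ _t : Unit, ∫ U, (Real.sqrt (β k) * ζ U p a) ^ 2 ∂μ k ≤ 2 * A := by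
      filter_upwards [hPE, hβ0] with k hk hk0
      simp only [Finset.univ_unique, Finset.sum_singleton]
      calc ∫ U, (Real.sqrt (β k) * ζ U p a) ^ 2 ∂μ k ≤ ∑ a', ∫ U, (Real.sqrt (β k) * ζ U p a') ^ 2 ∂μ k :=
            Finset.single_le_sum (f := fun a' => ∫ U, (Real.sqrt (β k) * ζ U p a') ^ 2 ∂μ k)
              (fun a' _ => integral_nonneg fun U => sq_nonneg _) (Finset.mem_univ a)
        _ ≤ 2 * (β k * ∫ U, E p U ∂μ k) := hζsum k p hk0
        _ ≤ 2 * A := by linarith [(hk (μ k) (hμ k) p).2]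
    refine TangentSecondMoments.integrable_of_integral_min_le ((TangentClosedLimit.measurable_eval₂ p a).pow_const 2)
      (fun Y => sq_nonneg _) fun M hM => ?_
    simpa only [Finset.univ_unique, Finset.sum_singleton] using core Unit (fun _ => p) (fun _ => a) (2 * A) hBd M hM
  -- (b) the budget at the origin, truncated at level `M`
  have partB : ∀ M : ℝ, 0 < M → ∑ t : {q : Fin 4 × Fin 4 // q.1 < q.2} × Fin (lieDim r),
      ∫ Y, min ((Y ((0 : Site 4), t.1) t.2) ^ 2) M ∂τ ≤ 3 * (lieDim r : ℝ) := by
    intro M hM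
    refine le_of_forall_pos_le_add fun ε hε => ?_
    refine core ({q : Fin 4 × Fin 4 // q.1 < q.2} × Fin (lieDim r)) (fun t => ((0 : Site 4), t.1)) (fun t => t.2)
      (3 * (lieDim r : ℝ) + ε) ?_ M hM
    filter_upwards [hβ.eventually (hequi (ε / 2) (half_pos hε)), hβ0] with k hk hk0
    have hsumE : ∀ U : LGConfig 4 G, ∑ q : {q : Fin 4 × Fin 4 // q.1 < q.2}, E ((0 : Site 4), q) U =
        ∑ i : Fin 4, ∑ j : Fin 4, if i < j then ((r.N : ℝ) - plaquetteObs r.ρ 0 i j U) else 0 :=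
      fun U => TangentSecondMoments.sum_subtype_lt fun q => (r.N : ℝ) - plaquetteObs r.ρ 0 q.1 q.2 U
    rw [Fintype.sum_prod_type]
    calc ∑ q : {q : Fin 4 × Fin 4 // q.1 < q.2}, ∑ a : Fin (lieDim r), ∫ U, (Real.sqrt (β k) * ζ U ((0 : Site 4), q) a) ^ 2 ∂μ k
        ≤ ∑ q : {q : Fin 4 × Fin 4 // q.1 < q.2}, 2 * (β k * ∫ U, E ((0 : Site 4), q) U ∂μ k) :=
          Finset.sum_le_sum fun q _ => hζsum k _ hk0
      _ = 2 * (β k * ∫ U, (∑ i : Fin 4, ∑ j : Fin 4, if i < j then ((r.N : ℝ) - plaquetteObs r.ρ 0 i j U) else 0) ∂μ k) := by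
          rw [← Finset.mul_sum, ← Finset.mul_sum]
          simp_rw [← hsumE]
          rw [integral_finsetSum _ fun q _ => hEi k ((0 : Site 4), q)]
      _ ≤ 2 * (3 * (lieDim r : ℝ) / 2 + ε / 2) := by linarith [(abs_lt.1 (hk (μ k) (hμ k))).2]
      _ = 3 * (lieDim r : ℝ) + ε := by ring
  refine ⟨⟨2 * A, partA⟩, ?_⟩
  -- pass to `M → ∞` in (b) by monotone convergence, then re-index the six planes
  have hlim : Tendsto (fun n : ℕ => ∑ t : {q : Fin 4 × Fin 4 // q.1 < q.2} × Fin (lieDim r),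
      ∫ Y, min ((Y ((0 : Site 4), t.1) t.2) ^ 2) ((n : ℝ) + 1) ∂τ) atTop
      (𝓝 (∑ t : {q : Fin 4 × Fin 4 // q.1 < q.2} × Fin (lieDim r), ∫ Y, (Y ((0 : Site 4), t.1) t.2) ^ 2 ∂τ)) :=
    tendsto_finsetSum _ fun t _ => TangentSecondMoments.tendsto_integral_min (partA _ _).1 fun Y => sq_nonneg _
  have hbud := le_of_tendsto' hlim fun n => partB _ (by positivity)
  rw [Fintype.sum_prod_type] at hbud
  calc ∑ i : Fin 4, ∑ j : Fin 4, ∑ a : Fin (lieDim r),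
        (if hij : i < j then ∫ Y, (Y ((0 : Site 4), ⟨(i, j), hij⟩) a) ^ 2 ∂τ else 0)
      = ∑ i : Fin 4, ∑ j : Fin 4, (if hij : i < j then
          ∑ a : Fin (lieDim r), ∫ Y, (Y ((0 : Site 4), ⟨(i, j), hij⟩) a) ^ 2 ∂τ else 0) :=
        Finset.sum_congr rfl fun i _ => Finset.sum_congr rfl fun j _ => by by_cases hij : i < j <;> simp [hij]
    _ = ∑ q : {q : Fin 4 × Fin 4 // q.1 < q.2}, ∑ a : Fin (lieDim r), ∫ Y, (Y ((0 : Site 4), q) a) ^ 2 ∂τ :=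
        (TangentSecondMoments.sum_subtype_lt_dite fun q => ∑ a : Fin (lieDim r), ∫ Y, (Y ((0 : Site 4), q) a) ^ 2 ∂τ).symm
    _ ≤ 3 * (lieDim r : ℝ) := hbud

end Summit.QuantumFields.YangMills.Theorems.EquipartitionPinsProbe

end
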